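import Summits.BirchSwinnertonDyer.BirchSwinnertonDyer.Theorems.ThetaPartnerAtTwoMazurTateCongruenceAtTwoRPlusLineOfManinConstant
import Summits.BirchSwinnertonDyer.BirchSwinnertonDyer.Theorems.AlignedTransportAtTwoMainConjectureTransportAlignedAtTwoBuzzardGalois
import Summits.BirchSwinnertonDyer.BirchSwinnertonDyer.Theorems.AlignedTransportAtTwoMainConjectureTransportAlignedAtTwoRhombicOfNegDisc
import Literature.NumberTheory.EllipticCurves.ModularParametrizationDegreeHoldsProofs
import HarnessLib

/-!
# Crux C1 `MainConjectureTransportAlignedAtTwo` (stmt-BirchSwinnertonDyer-22296), line `birth`: (K2) «PLUS MULTIPLICITY ONE MOD 2 ON THE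
# PERIOD HOMOLOGY» for an `S₃`-curve with `Δ < 0` and `Δ ∉ ℚ₂²` — the cell bsd-wall engine re-threaded for GOOD ORDINARY curves
# (lead att-p1 g9; `--supports 22296`)

THEOREMS ONLY (no `def`, no `sorry`, no new named fact). BSD is not proved by this; C1 is not closed by this.

Cell `bsd-wall` (crux `ThetaLayerLambdaCongruenceAtTwo`, line `birth`; files `…ThetaLayerLambdaCongruenceAtTwoStar*`,
`…MazurTateCongruenceAtTwoRPlusLine*`) proved (K2): for `W/ℚ` globally minimal, GOOD SUPERSINGULAR at `2`, `Δ_W < 0`, a newform `f` of level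
`N`, a nonempty finite set of primes `S`, an odd level `L` with `N·∏_{ℓ∈S} ℓ² ∣ L`, `primes(L) ⊆ S`, good reduction off `2L`, and the eigen-ideal
`𝔪₀ = (2, T_q − a_q(W) (q ∤ L), T_ℓ (ℓ ∣ L)) ⊆ 𝕋 = HeckeRing0 L 2`: every additive subgroup `K` of `S₂(Γ₀(L))^∨` containing `2Λ`, `𝔪₀^∨Λ` and the
cusp-negation differences (`Λ = H₁(X₀(L); ℤ) = periodHomology L`) has `x, y ∈ Λ ∖ K ⇒ x − y ∈ K` — i.e. the conjugation-coinvariants of `Λ/𝔪₀Λ`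
have ORDER ≤ 2. `GoodSS W 2` enters only through (i) `#E(ℚ)[2] = 1` (odd cyclic isogeny to the optimal quotient of the depleted form) and
(ii) the Galois side of Buzzard's mod-`2` multiplicity one. This file re-threads (K2) for the curves of crux C1: NO rational `2`-torsion abscissa
(gives (i) directly) and `Δ_W` NOT A SQUARE IN `ℚ₂` (gives (ii): `…BuzzardGalois.finrank_torsionBySet_eq_two_of_buzzard_S3`, p651832), keeping
`Δ_W < 0` (the rhombic Néron lattice is what makes complex conjugation non-trivial on `Λ/𝔪₀Λ`). Print inputs: `heckeSelfDual_torsionBy_J0` (SD),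
`buzzard2000_multiplicityOne_gamma0` (Bz); the Manin-constant input is the tree theorem `IsNewformOf.exists_maninConstant_ne_zero_holds`.

* §1 `exists_real_oddIndex_latticeBridge_of_ratTwoTorsionCard_eq_one`, `…iotaConj_add_notMem_of_optimalQuotient'`,
  `indexTwo_of_fourCosets_of_optimalQuotient'` — bsd-wall's B5 / (K2)-glue with `GoodSS` replaced by `#E(ℚ)[2] = 1`;
* §2 `kTwo_of_dvd_noMC'` — (K2) from `hsub` (Buzzard's conclusion at `𝔪₀`), MC, SD;
* §3 **`kTwo_of_dvd_S3`** — (K2) from {SD, Bz} for `W` with no rational `2`-torsion abscissa, `Δ_W < 0`, `Δ_W ∉ ℚ₂²`.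

References: Buzzard, MRL 7 (2000) Prop. 2.4 [Buzzard2000LevelLoweringModTwo]; Darmon–Diamond–Taylor §1.6 Lemma 1.38, §4.5 [DarmonDiamondTaylor1995];
Cremona, *Algorithms* (1997) §2.10 [CremonaAlgorithms1997]; BCDT JAMS 14 (2001) p. 845 [BCDTJAMS2001].
-/

noncomputable section

-- justification: the `Summit.BirchSwinnertonDyer.BirchSwinnertonDyer.…` path repeats a component (route-file convention)
set_option linter.dupNamespace false

open scoped MatrixGroups ComplexConjugate ModularForm NumberField Pointwise Classical
open CongruenceSubgroup Complex WeierstrassCurve IsDedekindDomain Polynomial Field Matrix Literature.NumberTheory.GaloisRepresentations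
open Literature.NumberTheory.EllipticCurves Literature.NumberTheory.EllipticCurves.ModularForms
open Literature.NumberTheory.EllipticCurves.Greenberg1999
open Literature.NumberTheory.EllipticCurves.Rank1Residual Rat.HeightOneSpectrum
open Summit.BirchSwinnertonDyer.BirchSwinnertonDyer.Theorems.ThetaLayerLambdaCongruenceAtTwo
open Summit.BirchSwinnertonDyer.BirchSwinnertonDyer.Theorems.AlignedTransportAtTwoBuzzardGalois

namespace Summit.BirchSwinnertonDyer.BirchSwinnertonDyer.Theorems.AlignedTransportAtTwoBuzzardKTwo

/-! ## §1 bsd-wall's B5 / (K2)-glue with `GoodSS W 2` replaced by `#E(ℚ)[2] = 1` -/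

/-- **Bridge hypothesis (H2) from `#E(ℚ)[2] = 1`** (bsd-wall's `exists_real_oddIndex_latticeBridge_of_goodSS_two` with `GoodSS W 2` replaced by
its only use, `ratTwoTorsionCard W = 1`): for a CYCLIC `ℚ`-isogeny `ψ : W → A` and Néron period pairs there are a real `α ≠ 0` and an ODD
`m = deg ψ` with `αΛ_W ⊆ Λ_A`, `m·Λ_A ⊆ αΛ_W`. [cite: SilvermanAEC2009, Thm. VI.4.1(b) and III.4] -/
theorem exists_real_oddIndex_latticeBridge_of_ratTwoTorsionCard_eq_one (W A : WeierstrassCurve ℚ) [W.IsElliptic]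
    [A.IsElliptic] (hcard : ratTwoTorsionCard W = 1) (ψ : Isogeny W A) (hcyc : ψ.IsCyclic)
    {LW LA : PeriodPair} (hLW : IsNeronLatticeOf (W.baseChange ℂ) LW)
    (hLA : IsNeronLatticeOf (A.baseChange ℂ) LA) :
    ∃ (α : ℝ) (m : ℕ), α ≠ 0 ∧ Odd m ∧ (∀ z ∈ LW.lattice, (α : ℂ) * z ∈ LA.lattice) ∧
      ∀ b ∈ LA.lattice, ∃ z ∈ LW.lattice, (m : ℂ) * b = (α : ℂ) * z := by
  obtain ⟨α, hα, hincl, hidx⟩ := ψ.exists_real_mul_lattice_le_of_isNeronLatticeOf hLW hLA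
  exact ⟨α, ψ.degree, hα, ψ.odd_degree_of_isCyclic_of_ratTwoTorsionCard_eq_one hcyc hcard, hincl, hidx⟩

/-- **ITEM B5 for an `S₃`-curve with `Δ < 0`** (bsd-wall's `exists_periodFunctional_iotaConj_add_notMem_of_optimalQuotient`, `GoodSS` ↦
`#E(ℚ)[2] = 1`): for `g ∈ S₂(Γ₀(L))` real, an optimal-quotient datum `(A, Λ_A = c·Λ_g)`, a cyclic `ℚ`-isogeny `ψ : W → A`, and an ideal
`𝔪 ⊆ 𝕋` acting on `g` by even integers, complex conjugation is not the identity on `Λ/𝔪Λ`. [cite: CremonaAlgorithms1997, §2.10 (pp. 29–30)] -/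
theorem exists_periodFunctional_iotaConj_add_notMem_of_optimalQuotient' (W : WeierstrassCurve ℚ) [W.IsElliptic]
    [W.IsGloballyMinimal] (hcard : ratTwoTorsionCard W = 1) (hΔ : W.Δ < 0) {L : ℕ} [NeZero L] (g : CuspForm (Gamma0 L) 2)
    (hreal : ∀ n, (cuspCoeff g n).im = 0)
    (A : WeierstrassCurve ℚ) [A.IsElliptic] {LA : PeriodPair} (hLA : IsNeronLatticeOf (A.baseChange ℂ) LA)
    {c : ℚ} (hc : c ≠ 0) (hlat : ∀ z : ℂ, z ∈ LA.lattice ↔ ∃ w ∈ periodLattice g, z = (c : ℂ) * w)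
    (ψ : Isogeny W A) (hcyc : ψ.IsCyclic)
    (𝔪 : Ideal (HeckeRing0 L 2)) (h𝔪 : ∀ t ∈ 𝔪, ∃ e : ℤ, HeckeRing0.toEnd L 2 t g = ((2 * e : ℤ) : ℂ) • g) :
    ∃ γ : Gamma0 L, periodFunctional L ⟨iotaConj (γ : SL(2, ℤ)), iotaConj_coe_mem_gamma0 γ⟩ + periodFunctional L γ ∉
      𝔪 • periodHomologyHecke L := by
  obtain ⟨LW, hLW⟩ := exists_isNeronLatticeOf W
  obtain ⟨α, m, hα, hm, hWB, hBW⟩ := exists_real_oddIndex_latticeBridge_of_ratTwoTorsionCard_eq_one W A hcard ψ hcyc hLW hLA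
  have hc' : (c : ℝ) ≠ 0 := by exact_mod_cast hc
  refine exists_periodFunctional_iotaConj_add_notMem_of_latticeBridge W hΔ hLW g hreal 𝔪 h𝔪
    LA.lattice.toAddSubgroup hc' (fun z ↦ ?_) hα hm (fun z hz ↦ hWB z hz) (fun b hb ↦ hBW b hb)
  rw [Submodule.mem_toAddSubgroup, hlat z, Complex.ofReal_ratCast]

/-- **B4 ∧ B5 ⇒ (K2), data level, for an `S₃`-curve with `Δ < 0`** (bsd-wall's `indexTwo_of_fourCosets_of_optimalQuotient`, `GoodSS` ↦
`#E(ℚ)[2] = 1`; statement otherwise verbatim). [cite: CremonaAlgorithms1997, §2.10 (pp. 29–30)] -/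
theorem indexTwo_of_fourCosets_of_optimalQuotient' (W : WeierstrassCurve ℚ) [W.IsElliptic] [W.IsGloballyMinimal]
    (hcard : ratTwoTorsionCard W = 1) (hΔ : W.Δ < 0) {L : ℕ} [NeZero L] (g : CuspForm (Gamma0 L) 2) (hreal : ∀ n, (cuspCoeff g n).im = 0)
    (A : WeierstrassCurve ℚ) [A.IsElliptic] {LA : PeriodPair} (hLA : IsNeronLatticeOf (A.baseChange ℂ) LA)
    {c : ℚ} (hc : c ≠ 0) (hlat : ∀ z : ℂ, z ∈ LA.lattice ↔ ∃ w ∈ periodLattice g, z = (c : ℂ) * w)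
    (ψ : Isogeny W A) (hcyc : ψ.IsCyclic)
    (𝔪 : Ideal (HeckeRing0 L 2)) (h2 : (2 : HeckeRing0 L 2) ∈ 𝔪)
    (h𝔪 : ∀ t ∈ 𝔪, ∃ e : ℤ, HeckeRing0.toEnd L 2 t g = ((2 * e : ℤ) : ℂ) • g)
    (K : AddSubgroup (Module.Dual ℂ (CuspForm (Gamma0 L) 2)))
    (hK𝔪 : ∀ x ∈ 𝔪 • periodHomologyHecke L, x ∈ K)
    (hKc : ∀ γ : Gamma0 L, periodFunctional L ⟨iotaConj (γ : SL(2, ℤ)), iotaConj_coe_mem_gamma0 γ⟩ - periodFunctional L γ ∈ K)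
    {v₁ v₂ : Module.Dual ℂ (CuspForm (Gamma0 L) 2)} (hv₂ : v₂ ∈ periodHomology L)
    (hcos : ∀ x ∈ periodHomology L, x ∈ 𝔪 • periodHomologyHecke L ∨ x - v₁ ∈ 𝔪 • periodHomologyHecke L ∨
      x - v₂ ∈ 𝔪 • periodHomologyHecke L ∨ x - (v₁ + v₂) ∈ 𝔪 • periodHomologyHecke L)
    {x y : Module.Dual ℂ (CuspForm (Gamma0 L) 2)} (hx : x ∈ periodHomology L) (hy : y ∈ periodHomology L)
    (hxK : x ∉ K) (hyK : y ∉ K) : x - y ∈ K := by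
  obtain ⟨LW, hLW⟩ := exists_isNeronLatticeOf W
  obtain ⟨α, m, hα, hm, hWB, hBW⟩ := exists_real_oddIndex_latticeBridge_of_ratTwoTorsionCard_eq_one W A hcard ψ hcyc hLW hLA
  have hc' : (c : ℝ) ≠ 0 := by exact_mod_cast hc
  have hrhg : ∃ z ∈ periodLattice g, ∀ w ∈ periodLattice g, z + conj z ≠ 2 * w :=
    periodLattice_rhombic_of_latticeBridge g (WeierstrassCurve.isReal_of_g₂_g₃_eq (K := ℚ) hLW.1 hLW.2)
      (W.neronLattice_rhombic_of_Δ_neg hΔ hLW) LA.lattice.toAddSubgroup hc'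
      (fun z ↦ by rw [Submodule.mem_toAddSubgroup, hlat z, Complex.ofReal_ratCast]) hα hm
      (fun z hz ↦ hWB z hz) (fun b hb ↦ hBW b hb)
  obtain ⟨γ₀, hγ₀⟩ := exists_periodFunctional_iotaConj_sub_notMem_ideal_smul g hreal 𝔪 h2 h𝔪 hrhg
  have huΛ : periodFunctional L ⟨iotaConj ((γ₀ : Gamma0 L) : SL(2, ℤ)), iotaConj_coe_mem_gamma0 γ₀⟩ - periodFunctional L γ₀ ∈
      periodHomology L := sub_mem (periodFunctional_mem_periodHomology L _) (periodFunctional_mem_periodHomology L γ₀)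
  refine sub_mem_of_notMem_of_fourCosets (periodHomology L) (𝔪 • periodHomologyHecke L).toAddSubgroup K
    (fun z hz ↦ hK𝔪 z hz) (fun z hz ↦ ?_) hv₂ (fun z hz ↦ hcos z hz) huΛ (hKc γ₀) hγ₀ hx hy hxK hyK
  rw [Submodule.mem_toAddSubgroup, ← Nat.cast_smul_eq_nsmul (HeckeRing0 L 2), Nat.cast_ofNat]
  exact Submodule.smul_mem_smul h2 ((mem_periodHomologyHecke L).mpr hz)

/-! ## §2 (K2) at a flexible level from `hsub`, MC and SD -/

/-- **ITEM B5 and (K2) at a flexible level, for an `S₃`-curve with `Δ < 0`** (bsd-wall's `kTwo_of_dvd_noMC` with `GoodSS W 2` replaced by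
«no rational `2`-torsion abscissa»; statement otherwise VERBATIM, proof copied with the two B5/(K2)-glue calls primed). `W/ℚ` globally minimal,
`∀ x, ¬ HasRationalTwoTorsionX W x`, `Δ_W < 0`; newform `f` of level `N`; `S` a nonempty finite set of primes; a level `L` with `N·∏_{ℓ∈S} ℓ² ∣ L`
and `primes(L) ⊆ S`; `𝔪₀ = span{2, T_q − a_q(W) (q ∤ L), T_ℓ (ℓ ∣ L)}`. Inputs: `IsNewformOf.exists_maninConstant_ne_zero`, Hecke self-duality of
`J₀(L)[2]`, and `hsub` (conclusion of `buzzard2000_multiplicityOne_gamma0` at `𝔪₀`). Conclusion (K2): every additive `K ⊇ 2Λ, (T_q^∨ − a_q(W))Λ,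
U_ℓ^∨Λ,` cusp-negation differences has `x, y ∈ Λ ∖ K ⇒ x − y ∈ K`. [cite: DarmonDiamondTaylor1995, §1.6 Lemma 1.38 and §4.5 Thm. 4.26]
[cite: Knapp1993, Thm. 11.74 (d)] -/
theorem kTwo_of_dvd_noMC'
    (hMC : IsNewformOf.exists_maninConstant_ne_zero)
    (hSD : heckeSelfDual_torsionBy_J0)
    (W : WeierstrassCurve ℚ) [W.IsElliptic] [W.IsGloballyMinimal] (ht : ∀ x : ℚ, ¬ HasRationalTwoTorsionX W x) (hΔ : W.Δ < 0)
    {N : ℕ} [NeZero N] {f : CuspForm (Gamma0 N) 2} (hf : IsNewformOf W f)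
    (S : Finset ℕ) (hS : ∀ ℓ ∈ S, ℓ.Prime) (_hSne : S.Nonempty)
    (L : ℕ) [NeZero L] (hNL : N * ∏ ℓ ∈ S, ℓ ^ 2 ∣ L) (hLS : ∀ p : ℕ, p.Prime → p ∣ L → p ∈ S)
    (hsub : Module.finrank (HeckeRing0 L 2 ⧸ Ideal.span ({t : HeckeRing0 L 2 | t = 2 ∨ (∃ (q : ℕ) (hq : q.Prime), ¬ q ∣ L ∧
          t = HeckeRing0.T L 2 q hq - (W.LFunction q : HeckeRing0 L 2)) ∨ (∃ (q : ℕ) (hq : q.Prime), q ∣ L ∧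
          t = HeckeRing0.T L 2 q hq)}))
      (Submodule.torsionBySet (HeckeRing0 L 2) (J0 L) (Ideal.span ({t : HeckeRing0 L 2 | t = 2 ∨
          (∃ (q : ℕ) (hq : q.Prime), ¬ q ∣ L ∧ t = HeckeRing0.T L 2 q hq - (W.LFunction q : HeckeRing0 L 2)) ∨
          (∃ (q : ℕ) (hq : q.Prime), q ∣ L ∧ t = HeckeRing0.T L 2 q hq)}))) = 2)
    (K : AddSubgroup (Module.Dual ℂ (CuspForm (Gamma0 L) 2)))
    (h2K : ∀ x ∈ periodHomology L, (2 : ℂ) • x ∈ K)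
    (hTK : ∀ (q : ℕ) (hq : q.Prime), ¬ q ∣ L → ∀ x ∈ periodHomology L,
      (haveI : NeZero q := ⟨hq.ne_zero⟩; heckeT (Gamma0 L) 2 q).dualMap x - (W.LFunction q : ℂ) • x ∈ K)
    (hUK : ∀ (q : ℕ) (hq : q.Prime), q ∣ L → ∀ x ∈ periodHomology L,
      (haveI : NeZero q := ⟨hq.ne_zero⟩; heckeT (Gamma0 L) 2 q).dualMap x ∈ K)
    (hcK : ∀ γ : Gamma0 L, periodFunctional L ⟨iotaConj (γ : SL(2, ℤ)), iotaConj_coe_mem_gamma0 γ⟩ - periodFunctional L γ ∈ K)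
    {x y : Module.Dual ℂ (CuspForm (Gamma0 L) 2)} (hx : x ∈ periodHomology L) (hy : y ∈ periodHomology L)
    (hxK : x ∉ K) (hyK : y ∉ K) : x - y ∈ K := by
  classical
  have hcard : ratTwoTorsionCard W = 1 := Summit.BirchSwinnertonDyer.BirchSwinnertonDyer.Theorems.AlignedTransportAtTwoRhombicOfNegDisc.ratTwoTorsionCard_eq_one_of_forall_not_hasRationalTwoTorsionX W ht
  set G : Set (HeckeRing0 L 2) := {t : HeckeRing0 L 2 | t = 2 ∨ (∃ (q : ℕ) (hq : q.Prime), ¬ q ∣ L ∧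
      t = HeckeRing0.T L 2 q hq - (W.LFunction q : HeckeRing0 L 2)) ∨ (∃ (q : ℕ) (hq : q.Prime), q ∣ L ∧
      t = HeckeRing0.T L 2 q hq)} with hGdef
  -- the depleted form at level `L`
  have hint : ∀ n : ℕ, ∃ z : ℤ, cuspCoeff f n = z := fun n ↦ ⟨W.LFunction n, hf.2 n⟩
  have hTf : ∀ (p : ℕ) (hp : p.Prime), (haveI : NeZero p := ⟨hp.ne_zero⟩; heckeT (Gamma0 N) 2 p f) = cuspCoeff f p • f :=
    fun p hp ↦ by haveI : NeZero p := ⟨hp.ne_zero⟩; exact hf.1.heckeT_eq_coeff_smul hp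
  have hLS' : ∀ p : ℕ, p.Prime → p ∣ L → p ∣ N ∨ p ∈ S := fun p hp h ↦ Or.inr (hLS p hp h)
  obtain ⟨g, hg', hgi, hgr, hg1, hgT, hgU, hgall⟩ := exists_depleted_eigenform_of_dvd f hint hf.1.2.2 hTf S hS L hNL hLS'
  have hg : ∀ n : ℕ, cuspCoeff g n = if ∃ ℓ ∈ S, ℓ ∣ n then 0 else (W.LFunction n : ℂ) := fun n ↦ by rw [hg' n, hf.2 n]
  -- primes of `L` are exactly `S`
  have hSL : ∀ ℓ ∈ S, ℓ ∣ L := fun ℓ hℓ ↦ (dvd_level_of_mem (M := N) (S := S) rfl hℓ).trans hNL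
  have hLiff : ∀ q : ℕ, q.Prime → (q ∣ L ↔ q ∈ S) := fun q hq ↦ ⟨hLS q hq, hSL q⟩
  -- the optimal quotient and `W ~ A`
  obtain ⟨A, hAell, hAmin, LA, c, hLA, hc, hlat, hiso⟩ :=
    MazurTateCongruenceAtTwoR.DepletedLattice.exists_depletedLatticeCurve_isIsogenous hMC W hf S hS L hNL g hg'
  obtain ⟨ψ, hcyc⟩ := hiso.exists_isCyclic
  -- the eigen-ideal acts on `g` by even integers and contains `2`
  have h2 : (2 : HeckeRing0 L 2) ∈ Ideal.span G := Ideal.subset_span (Or.inl rfl)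
  have hb : ∀ (q : ℕ) (hq : q.Prime), (haveI : NeZero q := ⟨hq.ne_zero⟩; heckeT (Gamma0 L) 2 q g) =
      (((if q ∈ S then 0 else W.LFunction q : ℤ)) : ℂ) • g := fun q hq ↦ by
    rw [hgall q hq, hg q]
    by_cases hqS : q ∈ S
    · rw [if_pos ⟨q, hqS, dvd_rfl⟩, if_pos hqS, Int.cast_zero]
    · rw [if_neg, if_neg hqS]
      rintro ⟨ℓ, hℓ, hd⟩
      exact hqS (((Nat.prime_dvd_prime_iff_eq (hS ℓ hℓ) hq).mp hd) ▸ hℓ)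
  have h𝔪 : ∀ t ∈ Ideal.span G, ∃ e : ℤ, HeckeRing0.toEnd L 2 t g = ((2 * e : ℤ) : ℂ) • g := by
    refine ideal_span_acts_even g (fun q ↦ if q ∈ S then 0 else W.LFunction q) hb G fun t ht ↦ ?_
    rcases ht with rfl | ⟨q, hq, hqL, rfl⟩ | ⟨q, hq, hqL, rfl⟩
    · exact Or.inl rfl
    · refine Or.inr ⟨q, hq, ?_⟩
      rw [if_neg (fun h ↦ hqL ((hLiff q hq).mpr h))]
    · refine Or.inr ⟨q, hq, ?_⟩
      rw [if_pos ((hLiff q hq).mp hqL), Int.cast_zero, sub_zero]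
  -- B5 at level `L`: a witness outside `𝔪₀Λ`, hence `𝔪₀ ≠ ⊤`, `|𝕋/𝔪₀| = 2`, maximal
  obtain ⟨γ₀, hγ₀⟩ := exists_periodFunctional_iotaConj_add_notMem_of_optimalQuotient' W hcard hΔ g hgr A hLA hc hlat ψ hcyc
    (Ideal.span G) h𝔪
  have hne : Ideal.span G ≠ ⊤ := by
    intro htop
    apply hγ₀
    rw [htop, Submodule.top_smul]
    exact (mem_periodHomologyHecke L).mpr
      (add_mem (periodFunctional_mem_periodHomology L _) (periodFunctional_mem_periodHomology L γ₀))
  have hq := natCard_quotient_eq_two_of_ne_top (Ideal.span G) h2 (eigenIdeal_T_sub_int_mem W) hne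
  haveI : (Ideal.span G).IsMaximal := isMaximal_of_natCard_quotient_eq_two _ hq
  -- B4 quotient form from `hsub` and the self-duality pairing, then the (K2) glue
  obtain ⟨B, hbal, hleft, -⟩ := hSD L 2
  obtain ⟨v₁, -, v₂, hv₂, hcos⟩ := exists_fourCosets_periodHomology_of_multiplicityOne _ h2 hq hsub B hbal hleft
  have hK𝔪 : ∀ z ∈ Ideal.span G • periodHomologyHecke L, z ∈ K := by
    refine mem_of_mem_ideal_span_smul G K fun s hs z hz ↦ ?_
    rcases hs with rfl | ⟨q, hq', hqL, rfl⟩ | ⟨q, hq', hqL, rfl⟩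
    · have : (2 : HeckeRing0 L 2) • z = (2 : ℂ) • z := by
        rw [show (2 : HeckeRing0 L 2) = ((2 : ℤ) : HeckeRing0 L 2) by norm_num, heckeRing0_intCast_smul, Int.cast_ofNat]
      rw [this]
      exact h2K z hz
    · rw [sub_smul, heckeRing0_T_smul, heckeRing0_intCast_smul]
      exact hTK q hq' hqL z hz
    · rw [heckeRing0_T_smul]
      exact hUK q hq' hqL z hz
  exact indexTwo_of_fourCosets_of_optimalQuotient' W hcard hΔ g hgr A hLA hc hlat ψ hcyc (Ideal.span G) h2 h𝔪 K hK𝔪 hcK hv₂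
    hcos hx hy hxK hyK

/-! ## §3 (K2) from {SD, Bz} for an `S₃`-curve with `Δ < 0`, `Δ ∉ ℚ₂²` -/

/-- **(K2) «plus multiplicity one mod 2 on the period homology» for an `S₃`-curve with `Δ_W < 0` and `Δ_W` not a `2`-adic square, from
{Hecke self-duality of `J₀(L)[2]`, Buzzard 2000 Prop. 2.4} and the tree's Manin-constant theorem.** `W/ℚ` globally minimal without rational
`2`-torsion abscissa, `Δ_W < 0`, `∀ s : ℚ_[2], s² ≠ Δ_W`; newform `f` of level `N`; `S ≠ ∅` finite set of primes; `L` odd with `N·∏_{ℓ∈S} ℓ² ∣ L`,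
`primes(L) ⊆ S`, good reduction at every `p ∤ 2L`. Then every additive `K ⊇ 2Λ, (T_q^∨ − a_q(W))Λ, U_ℓ^∨Λ,` cusp-negation differences
(`Λ = periodHomology L`) has `x, y ∈ Λ ∖ K ⇒ x − y ∈ K`. (The case `𝔪₀ = ⊤` is vacuous; otherwise `𝔪₀` is maximal with `|𝕋/𝔪₀| = 2` and
Buzzard's hypotheses are `…BuzzardGalois.finrank_torsionBySet_eq_two_of_buzzard_S3`.)
[cite: Buzzard2000LevelLoweringModTwo, Prop. 2.4 and Def. 2.1–2.2 (p. 100–101)] [cite: DarmonDiamondTaylor1995, §1.6 Lemma 1.38 and §4.5 Thm. 4.26] -/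
theorem kTwo_of_dvd_S3
    (hSD : heckeSelfDual_torsionBy_J0) (hBz : buzzard2000_multiplicityOne_gamma0)
    (W : WeierstrassCurve ℚ) [W.IsElliptic] [W.IsGloballyMinimal] (ht : ∀ x : ℚ, ¬ HasRationalTwoTorsionX W x) (hΔ : W.Δ < 0)
    (hΔ₂ : ∀ s : ℚ_[2], s ^ 2 ≠ (W.Δ : ℚ_[2]))
    {N : ℕ} [NeZero N] {f : CuspForm (Gamma0 N) 2} (hf : IsNewformOf W f)
    (S : Finset ℕ) (hS : ∀ ℓ ∈ S, ℓ.Prime) (hSne : S.Nonempty)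
    (L : ℕ) [NeZero L] (hL : Odd L) (hNL : N * ∏ ℓ ∈ S, ℓ ^ 2 ∣ L) (hLS : ∀ p : ℕ, p.Prime → p ∣ L → p ∈ S)
    (hgood : ∀ v : HeightOneSpectrum (𝓞 ℚ), ¬ ((primesEquiv v : ℕ) ∣ 2 * L) → W.HasGoodReductionAt v)
    (K : AddSubgroup (Module.Dual ℂ (CuspForm (Gamma0 L) 2)))
    (h2K : ∀ x ∈ periodHomology L, (2 : ℂ) • x ∈ K)
    (hTK : ∀ (q : ℕ) (hq : q.Prime), ¬ q ∣ L → ∀ x ∈ periodHomology L,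
      (haveI : NeZero q := ⟨hq.ne_zero⟩; heckeT (Gamma0 L) 2 q).dualMap x - (W.LFunction q : ℂ) • x ∈ K)
    (hUK : ∀ (q : ℕ) (hq : q.Prime), q ∣ L → ∀ x ∈ periodHomology L,
      (haveI : NeZero q := ⟨hq.ne_zero⟩; heckeT (Gamma0 L) 2 q).dualMap x ∈ K)
    (hcK : ∀ γ : Gamma0 L, periodFunctional L ⟨iotaConj (γ : SL(2, ℤ)), iotaConj_coe_mem_gamma0 γ⟩ - periodFunctional L γ ∈ K)
    {x y : Module.Dual ℂ (CuspForm (Gamma0 L) 2)} (hx : x ∈ periodHomology L) (hy : y ∈ periodHomology L)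
    (hxK : x ∉ K) (hyK : y ∉ K) : x - y ∈ K := by
  classical
  set G : Set (HeckeRing0 L 2) := {t : HeckeRing0 L 2 | t = 2 ∨ (∃ (q : ℕ) (hq : q.Prime), ¬ q ∣ L ∧
      t = HeckeRing0.T L 2 q hq - (W.LFunction q : HeckeRing0 L 2)) ∨ (∃ (q : ℕ) (hq : q.Prime), q ∣ L ∧
      t = HeckeRing0.T L 2 q hq)} with hGdef
  by_cases hne : Ideal.span G = ⊤
  · -- vacuous case: `K ⊇ 𝔪₀Λ = Λ ∋ x`
    exfalso
    apply hxK
    have hK𝔪 : ∀ z ∈ Ideal.span G • periodHomologyHecke L, z ∈ K := by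
      refine mem_of_mem_ideal_span_smul G K fun s hs z hz ↦ ?_
      rcases hs with rfl | ⟨q, hq', hqL, rfl⟩ | ⟨q, hq', hqL, rfl⟩
      · have : (2 : HeckeRing0 L 2) • z = (2 : ℂ) • z := by
          rw [show (2 : HeckeRing0 L 2) = ((2 : ℤ) : HeckeRing0 L 2) by norm_num, heckeRing0_intCast_smul, Int.cast_ofNat]
        rw [this]
        exact h2K z hz
      · rw [sub_smul, heckeRing0_T_smul, heckeRing0_intCast_smul]
        exact hTK q hq' hqL z hz
      · rw [heckeRing0_T_smul]
        exact hUK q hq' hqL z hz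
    apply hK𝔪
    rw [hne, Submodule.top_smul]
    exact (mem_periodHomologyHecke L).mpr hx
  · have h2 : (2 : HeckeRing0 L 2) ∈ Ideal.span G := Ideal.subset_span (Or.inl rfl)
    have hq := natCard_quotient_eq_two_of_ne_top (Ideal.span G) h2 (eigenIdeal_T_sub_int_mem W) hne
    haveI h𝔪 : (Ideal.span G).IsMaximal := isMaximal_of_natCard_quotient_eq_two _ hq
    have hT : ∀ (q : ℕ) (hq' : q.Prime), ¬ q ∣ L →
        HeckeRing0.T L 2 q hq' - (W.LFunction q : HeckeRing0 L 2) ∈ Ideal.span G :=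
      fun q hq' hqL ↦ Ideal.subset_span (Or.inr (Or.inl ⟨q, hq', hqL, rfl⟩))
    have hsub := finrank_torsionBySet_eq_two_of_buzzard_S3 hBz W ht hΔ₂ L hL hgood (Ideal.span G) h𝔪 h2 hq hT
    exact kTwo_of_dvd_noMC' IsNewformOf.exists_maninConstant_ne_zero_holds hSD W ht hΔ hf S hS hSne L hNL hLS hsub K h2K hTK hUK
      hcK hx hy hxK hyK

end Summit.BirchSwinnertonDyer.BirchSwinnertonDyer.Theorems.AlignedTransportAtTwoBuzzardKTwo

end
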